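import Summits.QuantumFields.BalabanUV.Beta.GAN24.S3RowV0
import Summits.QuantumFields.BalabanUV.Beta.GAN24.RowV0TableSymAt
import Summits.QuantumFields.BalabanUV.Beta.GAN24.E3UnitSplitLevelsVSymAt

/-!
# `BalabanUV.Beta.GAN24.S3RowV0SymAt` (SYMMETRIC comb table, OWNER W15; the `mfNeg` twin is `S3RowV0At` p298689) — binder row G-an2-4 / (CONV-C), road S3 AT THE IN-BLOCK ROOT, V half: package (ρV-c), part 2, of «ROOTED-S3-V»
# (OWNER gan24-p1-g21 (W11) «GO NOW, WANTED»; `gen21/BORNV-PLAN-v0.md` §3) — **ROAD S3's BIRTH-0 V ROW (`S3RowV0.shapeV0`) RE-RUN FOR an1's ROOTED (V-H)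
# TABLE `vhSAt (toSite r) 3 Lc`** ⇒ END **`shapeV0_at`**: `∃ c₀V δ, 0 ≤ c₀V ∧ 0 < δ ∧ ∀ r ∈ box (3+1) Lc, ∀ n, LocStencil (N^{2(d+1)}·e3OfS N (((Lc^4)^(n+1)·cVH) •
# pushSum Lc (Lc^(n+1)) (vhSAt (toSite r) 3 Lc κ u))) (c₀V·(Lc⁻¹)^(n+1)) δ` — the SAME constants as the base row, constants BEFORE the root.

NOT IN PRINT; OUR BOOKKEEPING (unit `b2b-balaban-gan24-p2`, gen 33 = prover-b2b-balaban-gan24-p2-g33-0, road-P2 chair of row G-an2-4; CRUX TEAM (2), 2026-08-21; the owner's gen-6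
`mkroot.py` METHOD: the base proof VERBATIM with `vhS 3 Lc ↦ vhSAt (toSite r) 3 Lc`, one extra binder `(hr : r ∈ box (3+1) Lc)`, MY `RowV0TableAt.table_suppR_*` ∕ `table_mass2_*`
and `E3UnitSplitLevelsVAt.e3VH0_unit_split_at` in place of the base table facts ∕ template; everything else BY NAME; base modules untouched).  [folklore]; 0 `def`, 0 cited
facts, 0 `def … : Prop`, 0 sorry; NO new estimate of Bałaban's.  HONEST FRAMING (cell contract, verbatim): «discharging `BetaPertH` makes Bałaban's UV stability
UNCONDITIONAL — a real constructive-QFT result; it is NOT the continuum limit and NOT the Clay problem.»  HONEST DEPENDENCY (verbatim): «continuum YM on T⁴ ⇐ BetaPertH ∧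
nine spine estimates (0/9 proved); BetaPertH ⇐ (D1) ∧ (D4) ∧ CAP+tail; G-an2-4 gates asym, D1 and NE2/3/4.»  Discharges NOTHING of (hS, hSall) ∕ hB by itself (an INPUT of the
V half's (V-U) `BornBorderUndressedRow`); NEVER «G-an2-4 closed»; NOT D1, NOT BetaPertH, NOT continuum, NOT Clay.
-/

noncomputable section

open Finset
open scoped BigOperators
open Literature.MathematicalPhysics.QuantumFieldTheory
open Literature.MathematicalPhysics.QuantumFieldTheory.Balaban1983to89
open Literature.MathematicalPhysics.QuantumFieldTheory.Balaban1983to89.Beta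
open B12Sec2to5 (l1 l1_nonneg)
open ExpKernelCalculus (MKer Zl Zl_nonneg l1_sub_symm)
open LatticeForm (quo)
open KernelSpecInstance (wH)
open KKTFluctuationKernel (GamΦ)
open OneStepResolventKernel (Fib LocStencil KInv)
open AffineAveraging (box toSite)
open AveragingHessianKernels (ell)
open AveragingHessianKernelsRooted (vhSAt)
open BalabanCompositeJets (pushSum)
open Summit.QuantumFields.BalabanUV.Beta.GAN24.E3UnitSplit (e3OfS e3OfS_inl_inr e3OfS_inr)
open Summit.QuantumFields.BalabanUV.Beta.GAN24.E3UnitSplitLevelsVSymAt (e3VH0_unit_split_at)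
open Summit.QuantumFields.BalabanUV.Beta.GAN24.TaylorVHSandwich (abs_twoChannel_le)
open Summit.QuantumFields.BalabanUV.Beta.GAN24.StencilSlotE3PhiLeg (phiLeg_three)
open Summit.QuantumFields.BalabanUV.Beta.GAN24.StencilSlotE3HLeg (legs_three)
open Summit.QuantumFields.BalabanUV.Beta.GAN24.RowV0TableSymAt (table_suppR_mf table_suppR_fm table_mass2_mf table_mass2_fm)
open Summit.QuantumFields.BalabanUV.Beta.GAN24.S3RowV0 (leg_mono)

namespace Summit.QuantumFields.BalabanUV.Beta.GAN24.S3RowV0SymAt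

variable {Lc : ℕ} [NeZero Lc]

/-! ## §1 One constant and one rate for all legs -/

/-! ## §2 ROW V0 -/

/-- **SHAPE ROW S3-V0 AT THE IN-BLOCK ROOT, UNCONDITIONAL** (`d = 3`, `Lc ≥ 1`; constants BEFORE the root): for every `r ∈ box (3+1) Lc` and every `n`, the
level-0 ROOTED SYMMETRIC (V-H) piece `vhSAt (toSite r) 3 Lc κ u` (no `mfNeg`) pushed `n+1` times, read by the normalised third-jet functional of member `n+2`, is a local stencil
family with constant `c₀V·(Lc⁻¹)^{n+1}` — the base `S3RowV0.shapeV0` with `vhS ↦ vhSAt (toSite r)`, the SAME `c₀V`, `δ`.  Engines BY NAME: MY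
`E3UnitSplitLevelsVAt.e3VH0_unit_split_at`, `TaylorVHSandwich.abs_twoChannel_le`, `StencilSlotE3PhiLeg.phiLeg_three`, `StencilSlotE3HLeg.legs_three`, MY `RowV0TableAt`,
the base's `leg_mono`. [folklore] -/
theorem shapeV0_at (hL : 1 ≤ Lc) (cVH : ℝ) :
    ∃ c₀V δ : ℝ, 0 ≤ c₀V ∧ 0 < δ ∧ ∀ (r : Fin (3 + 1) → ℕ), r ∈ box (3 + 1) Lc → ∀ n : ℕ,
      LocStencil (fun κ' u' x' z' a b => ((Lc : ℝ) ^ (n + 1 + 1)) ^ (2 * (3 + 1)) *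
        e3OfS (Lc ^ (n + 1 + 1)) (fun κ u => ((((Lc : ℝ) ^ (3 + 1)) ^ (n + 1)) * cVH) • pushSum Lc (Lc ^ (n + 1)) (vhSAt (toSite r) 3 Lc rfl κ u))
          κ' u' x' z' a b) (c₀V * ((Lc : ℝ)⁻¹) ^ (n + 1)) δ := by
  -- legs: one constant `A`, one rate `κ₁`
  obtain ⟨CΦ, δΦ, hδΦ, hCΦ, hΦrow, hΦcol⟩ := phiLeg_three (Lc := Lc)
  obtain ⟨CH, κH, hκH, hCH, hHleg, hGleg⟩ := legs_three (Lc := Lc)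
  set A : ℝ := max CΦ CH with hA
  have hA0 : 0 ≤ A := hCΦ.trans (le_max_left _ _)
  set κ₁ : ℝ := min δΦ κH with hκ₁
  have hκ₁pos : 0 < κ₁ := lt_min hδΦ hκH
  have hL0 : (0 : ℝ) < Lc := by exact_mod_cast (show 0 < Lc by omega)
  -- the n-free table mass unit and the sandwich constant
  set B₂ : ℝ := (((2 * (2 * (3 + 1) * Lc) + 1 : ℕ) : ℝ) ^ (3 + 1) *
      (((2 * (2 * (3 + 1) * Lc) + 1 : ℕ) : ℝ) ^ (3 + 1) * (3 * (ell (3 + 1) Lc : ℝ) ^ 2))) with hB₂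
  have hB₂0 : 0 ≤ B₂ := by positivity
  have hZ : 0 ≤ Zl (3 + 1) (κ₁ / 2) := Zl_nonneg (by positivity)
  set K : ℝ := 2 * ((Fintype.card (Fin (3 + 1)) : ℝ) ^ 3 * A ^ 3 * Real.exp (κ₁ * (4 * (3 + 1) * (8 * (3 + 1)) + 2 * (3 + 1))) * B₂ *
      Zl (3 + 1) (κ₁ / 2)) with hK
  have hK0 : 0 ≤ K := by positivity
  set c₀V : ℝ := |cVH| / (Lc : ℝ) ^ (3 + 1) * ((Lc : ℝ) ^ 2)⁻¹ * K with hc₀V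
  have hc₀V0 : 0 ≤ c₀V := by positivity
  refine ⟨c₀V, κ₁ / 2, hc₀V0, by positivity, fun r hr n => ?_⟩
  intro κ' u' x' z' a b
  dsimp only
  have hRHS : 0 ≤ c₀V * ((Lc : ℝ)⁻¹) ^ (n + 1) * Real.exp (-(κ₁ / 2) * (l1 (x' - u') + l1 (z' - u'))) := by positivity
  rcases a with α | μ
  · rcases b with β | ν
    · -- the field–field block: the two-channel template
      rw [e3VH0_unit_split_at (Lc := Lc) (d := 3) (toSite r) cVH (n + 1) (n + 1 + 1) rfl κ' u' x' z' α β]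
      have ecast : (((Lc ^ (n + 1 + 1) : ℕ) : ℝ)) = (Lc : ℝ) ^ (n + 1 + 1) := by push_cast; ring
      have hmP : 0 ≤ (Lc : ℝ) ^ (n + 1) * B₂ := mul_nonneg (pow_nonneg hL0.le _) hB₂0
      haveI : NeZero (Lc ^ (n + 1 + 1)) := ⟨pow_ne_zero _ (NeZero.ne Lc)⟩
      have h2 := abs_twoChannel_le (N := Lc ^ (n + 1 + 1)) (ι := Fin (3 + 1))
        (fun w l => ((Lc : ℝ) ^ (n + 1 + 1)) ^ (2 * (3 + 1)) *
          KInv (N := Lc ^ (n + 1 + 1)) (d := 3) (((Lc ^ (n + 1 + 1) : ℕ) : ℤ) • x') w (Sum.inr α) (Sum.inr l))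
        (fun w l => ((Lc : ℝ) ^ (n + 1 + 1)) ^ (3 + 2) * GamΦ (N := Lc ^ (n + 1 + 1)) α x' l w)
        (fun k u => ((Lc : ℝ) ^ (n + 1 + 1)) ^ (3 + 2) * wH (N := Lc ^ (n + 1 + 1)) k κ' (u - ((Lc ^ (n + 1 + 1) : ℕ) : ℤ) • u'))
        (fun y l' => ((Lc : ℝ) ^ (n + 1 + 1)) ^ (3 + 2) * wH (N := Lc ^ (n + 1 + 1)) l' β (y - ((Lc ^ (n + 1 + 1) : ℕ) : ℤ) • z'))
        (fun y l' => ((Lc : ℝ) ^ (n + 1 + 1)) ^ (2 * (3 + 1)) *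
          KInv (N := Lc ^ (n + 1 + 1)) (d := 3) y (((Lc ^ (n + 1 + 1) : ℕ) : ℤ) • z') (Sum.inr l') (Sum.inr β))
        (fun k u w y l l' => pushSum Lc (Lc ^ (n + 1)) (vhSAt (toSite r) 3 Lc rfl k u) w y (Sum.inr l) (Sum.inl l'))
        (fun k u w y l l' => pushSum Lc (Lc ^ (n + 1)) (vhSAt (toSite r) 3 Lc rfl k u) w y (Sum.inl l) (Sum.inr l'))
        (x' := x') (u' := u') (z' := z') (A := A) (κ := κ₁) (mP := (Lc : ℝ) ^ (n + 1) * B₂) (R := 8 * (3 + 1) * Lc ^ (n + 1 + 1))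
        hκ₁pos hA0 hmP
        (fun w l => leg_mono (hΦrow (n + 1) x' w α l) (le_max_left _ _) (min_le_left _ _) (l1_nonneg _) hCΦ)
        (fun w l => by
          have h := hGleg (n + 1) α l x' w
          rw [l1_sub_symm] at h
          exact leg_mono h (le_max_right _ _) (min_le_right _ _) (l1_nonneg _) hCH)
        (fun k u => leg_mono (hHleg (n + 1) k κ' u u') (le_max_right _ _) (min_le_right _ _) (l1_nonneg _) hCH)
        (fun y l' => leg_mono (hHleg (n + 1) l' β y z') (le_max_right _ _) (min_le_right _ _) (l1_nonneg _) hCH)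
        (fun y l' => leg_mono (hΦcol (n + 1) y z' l' β) (le_max_left _ _) (min_le_left _ _) (l1_nonneg _) hCΦ)
        (fun k u w y l l' h => table_suppR_mf hL hr (n + 1) k u w y l l' h)
        (fun k u w y l l' h => table_suppR_fm hL hr (n + 1) k u w y l l' h)
        (fun k u l l' S T => table_mass2_mf hL hr (n + 1) k u l l' S T)
        (fun k u l l' S T => table_mass2_fm hL hr (n + 1) k u l l' S T)
      rw [ecast] at h2
      -- the prefactor
      have hLp : (0 : ℝ) < ((Lc : ℝ) ^ (n + 1 + 1)) ^ 2 := by positivity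
      have hpre : |-(cVH / (Lc : ℝ) ^ (3 + 1)) * ((Lc : ℝ) ^ (n + 1 + 1)) ^ (-(2 : ℤ))| =
          |cVH| / (Lc : ℝ) ^ (3 + 1) * (((Lc : ℝ) ^ (n + 1 + 1)) ^ 2)⁻¹ := by
        rw [zpow_neg, zpow_ofNat, abs_mul, abs_neg, abs_div, abs_of_pos (pow_pos hL0 _), abs_inv, abs_of_pos hLp]
      -- the support ratio R/N = 8(3+1) is n-free
      have hRN : (4 : ℝ) * (3 + 1 : ℕ) * ((8 * (3 + 1) * Lc ^ (n + 1 + 1) : ℕ) : ℝ) / (Lc : ℝ) ^ (n + 1 + 1) + 2 * (3 + 1 : ℕ) =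
          4 * (3 + 1) * (8 * (3 + 1)) + 2 * (3 + 1) := by
        have hN0 : (Lc : ℝ) ^ (n + 1 + 1) ≠ 0 := pow_ne_zero _ hL0.ne'
        push_cast
        field_simp
        norm_num
      rw [hRN] at h2
      have hpow : (((Lc : ℝ) ^ (n + 1 + 1)) ^ 2)⁻¹ * (Lc : ℝ) ^ (n + 1) = ((Lc : ℝ) ^ 2)⁻¹ * ((Lc : ℝ)⁻¹) ^ (n + 1) := by
        have hL1 : (Lc : ℝ) ≠ 0 := hL0.ne'
        have e2 : ((Lc : ℝ) ^ (n + 1 + 1)) ^ 2 = (Lc : ℝ) ^ 2 * (Lc : ℝ) ^ (n + 1) * (Lc : ℝ) ^ (n + 1) := by ring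
        rw [e2, inv_pow, mul_inv, mul_inv, mul_assoc, mul_assoc, inv_mul_cancel₀ (pow_ne_zero _ hL1), mul_one]
      set E := Real.exp (-(κ₁ / 2) * (l1 (x' - u') + l1 (z' - u'))) with hE
      rw [abs_mul, hpre]
      calc |cVH| / (Lc : ℝ) ^ (3 + 1) * (((Lc : ℝ) ^ (n + 1 + 1)) ^ 2)⁻¹ * |_|
          ≤ |cVH| / (Lc : ℝ) ^ (3 + 1) * (((Lc : ℝ) ^ (n + 1 + 1)) ^ 2)⁻¹ *
              (2 * ((Fintype.card (Fin (3 + 1)) : ℝ) ^ 3 * A ^ 3 * Real.exp (κ₁ * (4 * (3 + 1) * (8 * (3 + 1)) + 2 * (3 + 1))) *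
                ((Lc : ℝ) ^ (n + 1) * B₂) * Zl (3 + 1) (κ₁ / 2) * E)) := mul_le_mul_of_nonneg_left h2 (by positivity)
        _ = |cVH| / (Lc : ℝ) ^ (3 + 1) * ((((Lc : ℝ) ^ (n + 1 + 1)) ^ 2)⁻¹ * (Lc : ℝ) ^ (n + 1)) * K * E := by rw [hK]; ring
        _ = c₀V * ((Lc : ℝ)⁻¹) ^ (n + 1) * E := by rw [hpow, hc₀V]; ring
    · simp only [e3OfS_inl_inr, mul_zero, abs_zero]
      exact hRHS
  · simp only [e3OfS_inr, mul_zero, abs_zero]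
    exact hRHS

end Summit.QuantumFields.BalabanUV.Beta.GAN24.S3RowV0SymAt

end
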